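import Literature.Algebra.Homology.KunnethH1Tensor
import Literature.AlgebraicGeometry.Motives.KunnethSectionsPi
import Literature.AlgebraicGeometry.Motives.KunnethSliceSections
import Literature.AlgebraicGeometry.Motives.KunnethH1SlicesProofs
import HarnessLib

/-!
# Proof of the Künneth injectivity for `Ȟ¹(𝒪)` on a product covering

This file DISCHARGES the named fact `kunneth_cechH1_productCover_slices_injective` of
`Motives/KunnethH1ProductCover` (Görtz–Wedhorn II, proof of Thm. 24.73 via the Künneth formula
Cor. 22.110 and `H⁰ = k`): for `X`, `Y` proper geometrically integral over a field `k` with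
rational points `x`, `y`, finite affine open coverings `(V_a)`, `(W_b)` of `X`, `Y` and the
product covering `𝒫 = (V_a ×_k W_b)`, a class in `Ȟ¹(𝒫, 𝒪_{X ×_k Y})` dying on the slices
`{x} × Y` and `X × {y}` is zero (`kunneth_cechH1_productCover_slices_injective_holds`). With the
reduction `kunneth_cechH1_slices_injective_of_productCover'` (`Motives/KunnethH1SlicesProofs`)
this also proves `kunneth_cechH1_slices_injective` (`kunneth_cechH1_slices_injective_holds`).

The proof is the degree-`1` shadow of the Künneth isomorphism, carried out on cochains:

1. **Terms.** `Γ(V_a ×_k W_b) = Γ(V_a) ⊗_k Γ(W_b)` and likewise for the pairwise intersections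
   `(V_a ∩ V_{a'}) ×_k W_b`, `V_a ×_k (W_b ∩ W_{b'})`, `(V_a ∩ V_{a'}) ×_k (W_b ∩ W_{b'})` (affine,
   `X`, `Y` being separated): the bijections `kunnethSectionsPi` of `Motives/KunnethSectionsPi`
   (Görtz–Wedhorn II, Cor. 22.110 in degree `0`), here `thetaHH`, `thetaVV`, `thetaHV`.
2. **Splitting a cocycle.** A `1`-cocycle `z` of `𝒫` has a horizontal part
   `z_h = (z_{(a,b),(a',b)})` and a vertical part `z_v = (z_{(a,b),(a,b')})`; the cocycle identity
   through the intermediate index `(a', b)` gives `z_{(a,b),(a',b')} = z_h| + z_v|` and the mixed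
   identity `δ'_v z_h = δ'_h z_v` (`cocycle_split`, `cocycle_mixed`). Transporting along the
   bijections of step 1 gives `h ∈ Č¹(𝒱) ⊗ Č⁰(𝒲)`, `v ∈ Č⁰(𝒱) ⊗ Č¹(𝒲)` with
   `(1 ⊗ d) h = (d ⊗ 1) v`.
3. **Slices.** Pulling back along `s_x = {x} × Y` kills `pr_X^*` up to evaluation at `x` and is
   the identity on `pr_Y^*` (`Motives/KunnethSliceSections`), so `s_x^* z = 0` in `Ȟ¹` says that
   `(ev_x ⊗ 1) v` is a coboundary of `𝒲` (`sliceMapLeft_thetaVV`); symmetrically for `y`.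
4. **Algebra.** `H⁰(X, 𝒪_X) = k = H⁰(Y, 𝒪_Y)` in the pointed Čech form
   `cechC0_eq_zero_of_cechD0_eq_zero` (Görtz–Wedhorn I, Prop. 12.66) feeds the abstract degree-`1`
   Künneth lemma `exists_tensor_primitive_of_slices` (`Literature/Algebra/Homology/KunnethH1Tensor`,
   Görtz–Wedhorn II, Prop. F.95): `h = (d ⊗ 1) g`, `v = (1 ⊗ d) g`.
5. **Conclusion.** `γ = Θ₀ g ∈ Č⁰(𝒫)` has `d⁰ γ = z` by step 2.

Mathlib searched (pin): `GeometricallyIntegral.isIntegral_of_subsingleton`, `IsAffineOpen.inf`,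
`TensorProduct.congr`, `TensorProduct.induction_on`, `Opens.mem_iSup` (used); Mathlib has no
Künneth formula and no Čech cohomology of schemes.

## References

* U. Görtz, T. Wedhorn, *Algebraic Geometry II: Cohomology of Schemes*, Springer Spektrum (2023),
  doi:10.1007/978-3-658-43031-3: Cor. 22.110; Thm. 22.9; Thm. 24.73 and its proof; Prop. F.95
  (read via the held copy, text chunks 0399, 0332, 0550, 0996). [GortzWedhorn2023]
* U. Görtz, T. Wedhorn, *Algebraic Geometry I: Schemes*, 2nd ed. (2020),
  doi:10.1007/978-3-658-30733-2: Prop. 4.17; Prop. 12.66. [GortzWedhorn2020]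
-/

universe u

open CategoryTheory CategoryTheory.Limits AlgebraicGeometry MonoidalCategory TensorProduct
open CartesianMonoidalCategory TopologicalSpace Opposite
open Literature.AlgebraicGeometry.Morphisms Literature.Algebra.Homology

noncomputable section

namespace Literature.AlgebraicGeometry.Motives

variable {k : Type u} [Field k]

/-! ### Pairwise intersections and uncurried `1`-cochains -/

/-- The family of pairwise intersections `(U_i ∩ U_j)_{(i,j)}`. [folklore] -/
abbrev pairInter {S : Scheme.{u}} {ι : Type u} (U : ι → S.Opens) : ι × ι → S.Opens :=
  fun ii => U ii.1 ⊓ U ii.2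

/-- `Č¹(𝒰, 𝒪) = Π_{i,j} Γ(U_i ∩ U_j)` as `0`-cochains of the family of pairwise intersections
(uncurrying). [folklore] -/
def cechC1Uncurry {S : Scheme.{u}} (f : S ⟶ Spec (.of k)) {ι : Type u} (U : ι → S.Opens) :
    CechC1 f U ≃ₗ[k] CechC0 f (pairInter U) :=
  piProdUncurry (k := k) fun i j => Sections f (U i ⊓ U j)

/-- Unfolding of `cechC1Uncurry`. [folklore] -/
@[simp]
theorem cechC1Uncurry_apply {S : Scheme.{u}} (f : S ⟶ Spec (.of k)) {ι : Type u}
    (U : ι → S.Opens) (c : CechC1 f U) (ii : ι × ι) : cechC1Uncurry f U c ii = c ii.1 ii.2 :=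
  rfl

/-- A two-term difference of restrictions between families of opens,
`m ↦ (m_{τ₂ t}|_{P₂ t} - m_{τ₁ t}|_{P₂ t})_t` (the shape of all Čech differentials in degree `0`).
[folklore] -/
def cechDiff {S : Scheme.{u}} (f : S ⟶ Spec (.of k)) {ι₁ ι₂ : Type u} (P₁ : ι₁ → S.Opens)
    (P₂ : ι₂ → S.Opens) (τ₁ τ₂ : ι₂ → ι₁) (h₁ : ∀ t, P₂ t ≤ P₁ (τ₁ t))
    (h₂ : ∀ t, P₂ t ≤ P₁ (τ₂ t)) : CechC0 f P₁ →ₗ[k] CechC0 f P₂ where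
  toFun m t := Sections.res f (h₂ t) (m (τ₂ t)) - Sections.res f (h₁ t) (m (τ₁ t))
  map_add' m m' := by
    funext t
    simp only [Pi.add_apply, map_add]
    abel
  map_smul' a m := by
    funext t
    simp only [Pi.smul_apply, map_smul, RingHom.id_apply, smul_sub]

/-- Unfolding of `cechDiff`. [folklore] -/
theorem cechDiff_apply {S : Scheme.{u}} (f : S ⟶ Spec (.of k)) {ι₁ ι₂ : Type u}
    (P₁ : ι₁ → S.Opens) (P₂ : ι₂ → S.Opens) (τ₁ τ₂ : ι₂ → ι₁) (h₁ : ∀ t, P₂ t ≤ P₁ (τ₁ t))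
    (h₂ : ∀ t, P₂ t ≤ P₁ (τ₂ t)) (m : CechC0 f P₁) (t : ι₂) :
    cechDiff f P₁ P₂ τ₁ τ₂ h₁ h₂ m t =
      Sections.res f (h₂ t) (m (τ₂ t)) - Sections.res f (h₁ t) (m (τ₁ t)) :=
  rfl

section Product

variable (X Y : SchemeOver k) {A B : Type u} (V : A → X.left.Opens) (W : B → Y.left.Opens)

/-! ### Inequalities between product opens -/

/-- `(V_a ∩ V_{a'}) × W_b ⊆ V_a × W_b`. [folklore] -/
theorem prod_pairInter_left_le_fst (t : (A × A) × B) :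
    productFamily X Y (pairInter V) W t ≤ productFamily X Y V W (t.1.1, t.2) :=
  prodOpen_mono X Y inf_le_left le_rfl

/-- `(V_a ∩ V_{a'}) × W_b ⊆ V_{a'} × W_b`. [folklore] -/
theorem prod_pairInter_left_le_snd (t : (A × A) × B) :
    productFamily X Y (pairInter V) W t ≤ productFamily X Y V W (t.1.2, t.2) :=
  prodOpen_mono X Y inf_le_right le_rfl

/-- `V_a × (W_b ∩ W_{b'}) ⊆ V_a × W_b`. [folklore] -/
theorem prod_pairInter_right_le_fst (t : A × (B × B)) :
    productFamily X Y V (pairInter W) t ≤ productFamily X Y V W (t.1, t.2.1) :=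
  prodOpen_mono X Y le_rfl inf_le_left

/-- `V_a × (W_b ∩ W_{b'}) ⊆ V_a × W_{b'}`. [folklore] -/
theorem prod_pairInter_right_le_snd (t : A × (B × B)) :
    productFamily X Y V (pairInter W) t ≤ productFamily X Y V W (t.1, t.2.2) :=
  prodOpen_mono X Y le_rfl inf_le_right

/-- `(V_a ∩ V_{a'}) × (W_b ∩ W_{b'}) ⊆ (V_a ∩ V_{a'}) × W_b`. [folklore] -/
theorem prod_pairInter_both_le_left_fst (t : (A × A) × (B × B)) :
    productFamily X Y (pairInter V) (pairInter W) t ≤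
      productFamily X Y (pairInter V) W (t.1, t.2.1) :=
  prodOpen_mono X Y le_rfl inf_le_left

/-- `(V_a ∩ V_{a'}) × (W_b ∩ W_{b'}) ⊆ (V_a ∩ V_{a'}) × W_{b'}`. [folklore] -/
theorem prod_pairInter_both_le_left_snd (t : (A × A) × (B × B)) :
    productFamily X Y (pairInter V) (pairInter W) t ≤
      productFamily X Y (pairInter V) W (t.1, t.2.2) :=
  prodOpen_mono X Y le_rfl inf_le_right

/-- `(V_a ∩ V_{a'}) × (W_b ∩ W_{b'}) ⊆ V_a × (W_b ∩ W_{b'})`. [folklore] -/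
theorem prod_pairInter_both_le_right_fst (t : (A × A) × (B × B)) :
    productFamily X Y (pairInter V) (pairInter W) t ≤
      productFamily X Y V (pairInter W) (t.1.1, t.2) :=
  prodOpen_mono X Y inf_le_left le_rfl

/-- `(V_a ∩ V_{a'}) × (W_b ∩ W_{b'}) ⊆ V_{a'} × (W_b ∩ W_{b'})`. [folklore] -/
theorem prod_pairInter_both_le_right_snd (t : (A × A) × (B × B)) :
    productFamily X Y (pairInter V) (pairInter W) t ≤
      productFamily X Y V (pairInter W) (t.1.2, t.2) :=
  prodOpen_mono X Y inf_le_right le_rfl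

/-- `(V_a × W_b) ∩ (V_{a'} × W_{b'}) = (V_a ∩ V_{a'}) × (W_b ∩ W_{b'})`, as an inequality.
[folklore] -/
theorem inf_productFamily_le_both (a a' : A) (b b' : B) :
    productFamily X Y V W (a, b) ⊓ productFamily X Y V W (a', b') ≤
      productFamily X Y (pairInter V) (pairInter W) ((a, a'), (b, b')) :=
  (prodOpen_inf X Y (V a) (V a') (W b) (W b')).le

/-- `(V_a ∩ V_{a'}) × (W_b ∩ W_{b'}) ⊆ V_a × W_b` etc. [folklore] -/
theorem prod_pairInter_both_le (t : (A × A) × (B × B)) :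
    productFamily X Y (pairInter V) (pairInter W) t ≤ productFamily X Y V W (t.1.1, t.2.1) ∧
    productFamily X Y (pairInter V) (pairInter W) t ≤ productFamily X Y V W (t.1.2, t.2.1) ∧
    productFamily X Y (pairInter V) (pairInter W) t ≤ productFamily X Y V W (t.1.1, t.2.2) ∧
    productFamily X Y (pairInter V) (pairInter W) t ≤ productFamily X Y V W (t.1.2, t.2.2) :=
  ⟨prodOpen_mono X Y inf_le_left inf_le_left, prodOpen_mono X Y inf_le_right inf_le_left,
    prodOpen_mono X Y inf_le_left inf_le_right, prodOpen_mono X Y inf_le_right inf_le_right⟩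

/-! ### `pr_X^*`, `pr_Y^*` into the members of a product covering

The maps of `Motives/KunnethSections` land in `Sections _ (prodOpen X Y V₀ W₀)`; the members of
the product covering are `productFamily X Y V W p`, the same opens up to unfolding definitions.
To keep all types syntactically uniform we re-type the maps by the covering. -/

/-- `pr_X^* : Γ(V_a) → Γ(V_a ×_k W_b)`, typed by the product covering. [folklore] -/
def comapFstP (p : A × B) :
    Sections X.hom (V p.1) →ₐ[k] Sections (X ⊗ Y).hom (productFamily X Y V W p) :=
  comapFst X Y (V p.1) (W p.2)

/-- `pr_Y^* : Γ(W_b) → Γ(V_a ×_k W_b)`, typed by the product covering. [folklore] -/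
def comapSndP (p : A × B) :
    Sections Y.hom (W p.2) →ₐ[k] Sections (X ⊗ Y).hom (productFamily X Y V W p) :=
  comapSnd X Y (V p.1) (W p.2)

/-- `kunnethSectionsPi (r ⊗ s) p = pr_X^*(r_{p.1}) · pr_Y^*(s_{p.2})`, covering-typed. [folklore] -/
theorem kunnethSectionsPi_tmul_P (r : CechC0 X.hom V) (s : CechC0 Y.hom W) (p : A × B) :
    kunnethSectionsPi X Y V W (r ⊗ₜ s) p =
      comapFstP X Y V W p (r p.1) * comapSndP X Y V W p (s p.2) :=
  rfl

variable {V W} in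
/-- Restriction between members of product coverings commutes with `pr_X^*`. [folklore] -/
theorem res_comapFstP {A' B' : Type u} {V' : A' → X.left.Opens} {W' : B' → Y.left.Opens}
    {p : A × B} {p' : A' × B'} (hV : V' p'.1 ≤ V p.1)
    (h : productFamily X Y V' W' p' ≤ productFamily X Y V W p) (r : Sections X.hom (V p.1)) :
    Sections.res (X ⊗ Y).hom h (comapFstP X Y V W p r) =
      comapFstP X Y V' W' p' (Sections.res X.hom hV r) :=
  res_comapFst X Y hV h r

variable {V W} in
/-- Restriction between members of product coverings commutes with `pr_Y^*`. [folklore] -/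
theorem res_comapSndP {A' B' : Type u} {V' : A' → X.left.Opens} {W' : B' → Y.left.Opens}
    {p : A × B} {p' : A' × B'} (hW : W' p'.2 ≤ W p.2)
    (h : productFamily X Y V' W' p' ≤ productFamily X Y V W p) (s : Sections Y.hom (W p.2)) :
    Sections.res (X ⊗ Y).hom h (comapSndP X Y V W p s) =
      comapSndP X Y V' W' p' (Sections.res Y.hom hW s) :=
  res_comapSnd X Y hW h s

section SliceP

variable {X Y V W}

/-- `W' ⊆ s_x⁻¹(V_a × W_b)` for `x ∈ V_a`, `W' ⊆ W_b` (covering-typed). [folklore] -/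
theorem le_preimage_sliceLeft_P {x : 𝟙_ (SchemeOver k) ⟶ X} {p : A × B}
    (hx : ratPt X x ∈ V p.1) {W' : Y.left.Opens} (hW : W' ≤ W p.2) :
    W' ≤ ((λ_ Y).inv ≫ x ▷ Y).left ⁻¹ᵁ productFamily X Y V W p :=
  le_preimage_sliceLeft_prodOpen hx hW

/-- `V' ⊆ s_y⁻¹(V_a × W_b)` for `y ∈ W_b`, `V' ⊆ V_a` (covering-typed). [folklore] -/
theorem le_preimage_sliceRight_P {y : 𝟙_ (SchemeOver k) ⟶ Y} {p : A × B}
    (hy : ratPt Y y ∈ W p.2) {V' : X.left.Opens} (hV : V' ≤ V p.1) :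
    V' ≤ ((ρ_ X).inv ≫ X ◁ y).left ⁻¹ᵁ productFamily X Y V W p :=
  le_preimage_sliceRight_prodOpen hy hV

/-- `s_x^*(pr_X^* r) = r(x)` (covering-typed). [folklore] -/
theorem comap_sliceLeft_comapFstP {x : 𝟙_ (SchemeOver k) ⟶ X} {p : A × B}
    (hx : ratPt X x ∈ V p.1) {W' : Y.left.Opens}
    (e : W' ≤ ((λ_ Y).inv ≫ x ▷ Y).left ⁻¹ᵁ productFamily X Y V W p)
    (r : Sections X.hom (V p.1)) :
    Sections.comap (X ⊗ Y).hom Y.hom ((λ_ Y).inv ≫ x ▷ Y).left (sliceLeft_left_comp_hom X Y x) e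
        (comapFstP X Y V W p r) =
      algebraMap k (Sections Y.hom W') (evalPt hx r) :=
  comap_sliceLeft_comapFst hx e r

/-- `s_x^*(pr_Y^* s) = s|_{W'}` (covering-typed). [folklore] -/
theorem comap_sliceLeft_comapSndP {x : 𝟙_ (SchemeOver k) ⟶ X} {p : A × B} {W' : Y.left.Opens}
    (hW : W' ≤ W p.2) (e : W' ≤ ((λ_ Y).inv ≫ x ▷ Y).left ⁻¹ᵁ productFamily X Y V W p)
    (s : Sections Y.hom (W p.2)) :
    Sections.comap (X ⊗ Y).hom Y.hom ((λ_ Y).inv ≫ x ▷ Y).left (sliceLeft_left_comp_hom X Y x) e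
        (comapSndP X Y V W p s) =
      Sections.res Y.hom hW s :=
  comap_sliceLeft_comapSnd hW e s

/-- `s_y^*(pr_Y^* s) = s(y)` (covering-typed). [folklore] -/
theorem comap_sliceRight_comapSndP {y : 𝟙_ (SchemeOver k) ⟶ Y} {p : A × B}
    (hy : ratPt Y y ∈ W p.2) {V' : X.left.Opens}
    (e : V' ≤ ((ρ_ X).inv ≫ X ◁ y).left ⁻¹ᵁ productFamily X Y V W p)
    (s : Sections Y.hom (W p.2)) :
    Sections.comap (X ⊗ Y).hom X.hom ((ρ_ X).inv ≫ X ◁ y).left (sliceRight_left_comp_hom X Y y) e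
        (comapSndP X Y V W p s) =
      algebraMap k (Sections X.hom V') (evalPt hy s) :=
  comap_sliceRight_comapSnd hy e s

/-- `s_y^*(pr_X^* r) = r|_{V'}` (covering-typed). [folklore] -/
theorem comap_sliceRight_comapFstP {y : 𝟙_ (SchemeOver k) ⟶ Y} {p : A × B} {V' : X.left.Opens}
    (hV : V' ≤ V p.1) (e : V' ≤ ((ρ_ X).inv ≫ X ◁ y).left ⁻¹ᵁ productFamily X Y V W p)
    (r : Sections X.hom (V p.1)) :
    Sections.comap (X ⊗ Y).hom X.hom ((ρ_ X).inv ≫ X ◁ y).left (sliceRight_left_comp_hom X Y y) e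
        (comapFstP X Y V W p r) =
      Sections.res X.hom hV r :=
  comap_sliceRight_comapFst hV e r

end SliceP

/-! ### The Künneth maps on the terms of the Čech complexes -/

/-- `Θ_h : Č¹(𝒱) ⊗ Č⁰(𝒲) → Π Γ((V_a ∩ V_{a'}) × W_b)`. [folklore] -/
def thetaHH : CechC1 X.hom V ⊗[k] CechC0 Y.hom W →ₗ[k]
    CechC0 (X ⊗ Y).hom (productFamily X Y (pairInter V) W) :=
  kunnethSectionsPi X Y (pairInter V) W ∘ₗ
    (TensorProduct.congr (cechC1Uncurry X.hom V) (LinearEquiv.refl k _)).toLinearMap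

/-- `Θ_v : Č⁰(𝒱) ⊗ Č¹(𝒲) → Π Γ(V_a × (W_b ∩ W_{b'}))`. [folklore] -/
def thetaVV : CechC0 X.hom V ⊗[k] CechC1 Y.hom W →ₗ[k]
    CechC0 (X ⊗ Y).hom (productFamily X Y V (pairInter W)) :=
  kunnethSectionsPi X Y V (pairInter W) ∘ₗ
    (TensorProduct.congr (LinearEquiv.refl k _) (cechC1Uncurry Y.hom W)).toLinearMap

/-- `Θ_hv : Č¹(𝒱) ⊗ Č¹(𝒲) → Π Γ((V_a ∩ V_{a'}) × (W_b ∩ W_{b'}))`. [folklore] -/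
def thetaHV : CechC1 X.hom V ⊗[k] CechC1 Y.hom W →ₗ[k]
    CechC0 (X ⊗ Y).hom (productFamily X Y (pairInter V) (pairInter W)) :=
  kunnethSectionsPi X Y (pairInter V) (pairInter W) ∘ₗ
    (TensorProduct.congr (cechC1Uncurry X.hom V) (cechC1Uncurry Y.hom W)).toLinearMap

/-- `Θ_h` on pure tensors. [folklore] -/
@[simp]
theorem thetaHH_tmul (c : CechC1 X.hom V) (s : CechC0 Y.hom W) (t : (A × A) × B) :
    thetaHH X Y V W (c ⊗ₜ s) t =
      comapFstP X Y (pairInter V) W t (c t.1.1 t.1.2) * comapSndP X Y (pairInter V) W t (s t.2) :=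
  rfl

/-- `Θ_v` on pure tensors. [folklore] -/
@[simp]
theorem thetaVV_tmul (r : CechC0 X.hom V) (c : CechC1 Y.hom W) (t : A × (B × B)) :
    thetaVV X Y V W (r ⊗ₜ c) t =
      comapFstP X Y V (pairInter W) t (r t.1) * comapSndP X Y V (pairInter W) t (c t.2.1 t.2.2) :=
  rfl

/-- `Θ_hv` on pure tensors. [folklore] -/
@[simp]
theorem thetaHV_tmul (c : CechC1 X.hom V) (c' : CechC1 Y.hom W) (t : (A × A) × (B × B)) :
    thetaHV X Y V W (c ⊗ₜ c') t =
      comapFstP X Y (pairInter V) (pairInter W) t (c t.1.1 t.1.2) *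
        comapSndP X Y (pairInter V) (pairInter W) t (c' t.2.1 t.2.2) :=
  rfl

/-- `Θ_h` is surjective for finite affine families (`X` separated). [folklore] -/
theorem thetaHH_surjective [Finite A] [Finite B] (hV₂ : ∀ aa, IsAffineOpen (pairInter V aa))
    (hW : ∀ b, IsAffineOpen (W b)) : Function.Surjective (thetaHH X Y V W) :=
  (kunnethSectionsPi_surjective X Y (pairInter V) W hV₂ hW).comp (LinearEquiv.surjective _)

/-- `Θ_v` is surjective for finite affine families (`Y` separated). [folklore] -/
theorem thetaVV_surjective [Finite A] [Finite B] (hV : ∀ a, IsAffineOpen (V a))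
    (hW₂ : ∀ bb, IsAffineOpen (pairInter W bb)) : Function.Surjective (thetaVV X Y V W) :=
  (kunnethSectionsPi_surjective X Y V (pairInter W) hV hW₂).comp (LinearEquiv.surjective _)

/-- `Θ_hv` is injective for finite affine families. [folklore] -/
theorem thetaHV_injective [Finite A] [Finite B] (hV₂ : ∀ aa, IsAffineOpen (pairInter V aa))
    (hW₂ : ∀ bb, IsAffineOpen (pairInter W bb)) : Function.Injective (thetaHV X Y V W) :=
  (kunnethSectionsPi_injective X Y (pairInter V) (pairInter W) hV₂ hW₂).comp
    (LinearEquiv.injective _)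

/-! ### The geometric difference maps and their naturality -/

/-- `δ_h : Č⁰(𝒫) → Π Γ((V_a ∩ V_{a'}) × W_b)`, `γ ↦ γ_{a'b}| - γ_{ab}|`. [folklore] -/
def deltaH : CechC0 (X ⊗ Y).hom (productFamily X Y V W) →ₗ[k]
    CechC0 (X ⊗ Y).hom (productFamily X Y (pairInter V) W) :=
  cechDiff (X ⊗ Y).hom _ _ (fun t => (t.1.1, t.2)) (fun t => (t.1.2, t.2))
    (prod_pairInter_left_le_fst X Y V W) (prod_pairInter_left_le_snd X Y V W)

/-- `δ_v : Č⁰(𝒫) → Π Γ(V_a × (W_b ∩ W_{b'}))`, `γ ↦ γ_{ab'}| - γ_{ab}|`. [folklore] -/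
def deltaV : CechC0 (X ⊗ Y).hom (productFamily X Y V W) →ₗ[k]
    CechC0 (X ⊗ Y).hom (productFamily X Y V (pairInter W)) :=
  cechDiff (X ⊗ Y).hom _ _ (fun t => (t.1, t.2.1)) (fun t => (t.1, t.2.2))
    (prod_pairInter_right_le_fst X Y V W) (prod_pairInter_right_le_snd X Y V W)

/-- `δ'_v : Π Γ((V_a ∩ V_{a'}) × W_b) → Π Γ((V_a ∩ V_{a'}) × (W_b ∩ W_{b'}))`. [folklore] -/
def deltaV' : CechC0 (X ⊗ Y).hom (productFamily X Y (pairInter V) W) →ₗ[k]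
    CechC0 (X ⊗ Y).hom (productFamily X Y (pairInter V) (pairInter W)) :=
  cechDiff (X ⊗ Y).hom _ _ (fun t => (t.1, t.2.1)) (fun t => (t.1, t.2.2))
    (prod_pairInter_both_le_left_fst X Y V W) (prod_pairInter_both_le_left_snd X Y V W)

/-- `δ'_h : Π Γ(V_a × (W_b ∩ W_{b'})) → Π Γ((V_a ∩ V_{a'}) × (W_b ∩ W_{b'}))`. [folklore] -/
def deltaH' : CechC0 (X ⊗ Y).hom (productFamily X Y V (pairInter W)) →ₗ[k]
    CechC0 (X ⊗ Y).hom (productFamily X Y (pairInter V) (pairInter W)) :=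
  cechDiff (X ⊗ Y).hom _ _ (fun t => (t.1.1, t.2)) (fun t => (t.1.2, t.2))
    (prod_pairInter_both_le_right_fst X Y V W) (prod_pairInter_both_le_right_snd X Y V W)

/-- **`Θ_h ∘ (d ⊗ 1) = δ_h ∘ Θ₀`.** [folklore] -/
theorem thetaHH_rTensor_cechD0 (g : CechC0 X.hom V ⊗[k] CechC0 Y.hom W) :
    thetaHH X Y V W ((cechD0 X.hom V).rTensor _ g) =
      deltaH X Y V W (kunnethSectionsPi X Y V W g) := by
  induction g using TensorProduct.induction_on with
  | zero => rw [map_zero, map_zero, map_zero, map_zero]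
  | add g g' hg hg' => rw [map_add, map_add, hg, hg', map_add, map_add]
  | tmul r s =>
    funext t
    rw [LinearMap.rTensor_tmul, thetaHH_tmul, deltaH, cechDiff_apply, kunnethSectionsPi_tmul_P,
      kunnethSectionsPi_tmul_P, map_mul, map_mul, cechD0_apply, map_sub,
      res_comapFstP X Y (p := (t.1.2, t.2)) (p' := t) (inf_le_right : V t.1.1 ⊓ V t.1.2 ≤ V t.1.2),
      res_comapSndP X Y (p := (t.1.2, t.2)) (p' := t) (le_refl (W t.2)),
      res_comapFstP X Y (p := (t.1.1, t.2)) (p' := t) (inf_le_left : V t.1.1 ⊓ V t.1.2 ≤ V t.1.1),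
      res_comapSndP X Y (p := (t.1.1, t.2)) (p' := t) (le_refl (W t.2)), Sections.res_self,
      sub_mul]

/-- **`Θ_v ∘ (1 ⊗ d) = δ_v ∘ Θ₀`.** [folklore] -/
theorem thetaVV_lTensor_cechD0 (g : CechC0 X.hom V ⊗[k] CechC0 Y.hom W) :
    thetaVV X Y V W ((cechD0 Y.hom W).lTensor _ g) =
      deltaV X Y V W (kunnethSectionsPi X Y V W g) := by
  induction g using TensorProduct.induction_on with
  | zero => rw [map_zero, map_zero, map_zero, map_zero]
  | add g g' hg hg' => rw [map_add, map_add, hg, hg', map_add, map_add]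
  | tmul r s =>
    funext t
    rw [LinearMap.lTensor_tmul, thetaVV_tmul, deltaV, cechDiff_apply, kunnethSectionsPi_tmul_P,
      kunnethSectionsPi_tmul_P, map_mul, map_mul, cechD0_apply, map_sub,
      res_comapFstP X Y (p := (t.1, t.2.2)) (p' := t) (le_refl (V t.1)),
      res_comapSndP X Y (p := (t.1, t.2.2)) (p' := t) (inf_le_right : W t.2.1 ⊓ W t.2.2 ≤ W t.2.2),
      res_comapFstP X Y (p := (t.1, t.2.1)) (p' := t) (le_refl (V t.1)),
      res_comapSndP X Y (p := (t.1, t.2.1)) (p' := t) (inf_le_left : W t.2.1 ⊓ W t.2.2 ≤ W t.2.1),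
      Sections.res_self, mul_sub]

/-- **`Θ_hv ∘ (1 ⊗ d) = δ'_v ∘ Θ_h`.** [folklore] -/
theorem thetaHV_lTensor_cechD0 (h : CechC1 X.hom V ⊗[k] CechC0 Y.hom W) :
    thetaHV X Y V W ((cechD0 Y.hom W).lTensor _ h) = deltaV' X Y V W (thetaHH X Y V W h) := by
  induction h using TensorProduct.induction_on with
  | zero => rw [map_zero, map_zero, map_zero, map_zero]
  | add g g' hg hg' => rw [map_add, map_add, hg, hg', map_add, map_add]
  | tmul c s =>
    funext t
    rw [LinearMap.lTensor_tmul, thetaHV_tmul, deltaV', cechDiff_apply, thetaHH_tmul,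
      thetaHH_tmul, map_mul, map_mul, cechD0_apply, map_sub,
      res_comapFstP X Y (p := (t.1, t.2.2)) (p' := t) (le_refl (V t.1.1 ⊓ V t.1.2)),
      res_comapSndP X Y (p := (t.1, t.2.2)) (p' := t) (inf_le_right : W t.2.1 ⊓ W t.2.2 ≤ W t.2.2),
      res_comapFstP X Y (p := (t.1, t.2.1)) (p' := t) (le_refl (V t.1.1 ⊓ V t.1.2)),
      res_comapSndP X Y (p := (t.1, t.2.1)) (p' := t) (inf_le_left : W t.2.1 ⊓ W t.2.2 ≤ W t.2.1),
      Sections.res_self, mul_sub]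

/-- **`Θ_hv ∘ (d ⊗ 1) = δ'_h ∘ Θ_v`.** [folklore] -/
theorem thetaHV_rTensor_cechD0 (v : CechC0 X.hom V ⊗[k] CechC1 Y.hom W) :
    thetaHV X Y V W ((cechD0 X.hom V).rTensor _ v) = deltaH' X Y V W (thetaVV X Y V W v) := by
  induction v using TensorProduct.induction_on with
  | zero => rw [map_zero, map_zero, map_zero, map_zero]
  | add g g' hg hg' => rw [map_add, map_add, hg, hg', map_add, map_add]
  | tmul r c =>
    funext t
    rw [LinearMap.rTensor_tmul, thetaHV_tmul, deltaH', cechDiff_apply, thetaVV_tmul,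
      thetaVV_tmul, map_mul, map_mul, cechD0_apply, map_sub,
      res_comapFstP X Y (p := (t.1.2, t.2)) (p' := t) (inf_le_right : V t.1.1 ⊓ V t.1.2 ≤ V t.1.2),
      res_comapSndP X Y (p := (t.1.2, t.2)) (p' := t) (le_refl (W t.2.1 ⊓ W t.2.2)),
      res_comapFstP X Y (p := (t.1.1, t.2)) (p' := t) (inf_le_left : V t.1.1 ⊓ V t.1.2 ≤ V t.1.1),
      res_comapSndP X Y (p := (t.1.1, t.2)) (p' := t) (le_refl (W t.2.1 ⊓ W t.2.2)),
      Sections.res_self, sub_mul]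

/-! ### The slices -/

section Slices

variable {X V} {x : 𝟙_ (SchemeOver k) ⟶ X} {a₀ : A} (ha₀ : ratPt X x ∈ V a₀)

/-- `σ_x : Π Γ(V_a × (W_b ∩ W_{b'})) → Č¹(𝒲)`, `m ↦ (s_x^* m_{a₀,b,b'})_{b,b'}` for `x ∈ V_{a₀}`.
[folklore] -/
def sliceMapLeft : CechC0 (X ⊗ Y).hom (productFamily X Y V (pairInter W)) →ₗ[k]
    CechC1 Y.hom W where
  toFun m b b' :=
    Sections.comap (X ⊗ Y).hom Y.hom ((λ_ Y).inv ≫ x ▷ Y).left (sliceLeft_left_comp_hom X Y x)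
      (le_preimage_sliceLeft_P (V := V) (W := pairInter W) (p := (a₀, (b, b'))) ha₀ le_rfl)
      (m (a₀, (b, b')))
  map_add' m m' := by
    funext b b'
    exact map_add (Sections.comap _ _ _ _ _) (m (a₀, (b, b'))) (m' (a₀, (b, b')))
  map_smul' a m := by
    funext b b'
    exact map_smul (Sections.comap _ _ _ _ _) a (m (a₀, (b, b')))

/-- Unfolding of `sliceMapLeft`. [folklore] -/
theorem sliceMapLeft_apply (m : CechC0 (X ⊗ Y).hom (productFamily X Y V (pairInter W)))
    (b b' : B) :
    sliceMapLeft Y W ha₀ m b b' =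
      Sections.comap (X ⊗ Y).hom Y.hom ((λ_ Y).inv ≫ x ▷ Y).left (sliceLeft_left_comp_hom X Y x)
        (le_preimage_sliceLeft_P (V := V) (W := pairInter W) (p := (a₀, (b, b'))) ha₀ le_rfl)
        (m (a₀, (b, b'))) :=
  rfl

/-- **`σ_x ∘ Θ_v = ev_x ⊗ 1`**: on `Č⁰(𝒱) ⊗ Č¹(𝒲)` the slice map is the contraction with the
evaluation `r ↦ r_{a₀}(x)`. [folklore] -/
theorem sliceMapLeft_thetaVV (g : CechC0 X.hom V ⊗[k] CechC1 Y.hom W) :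
    sliceMapLeft Y W ha₀ (thetaVV X Y V W g) =
      contractLeft k ((evalPt ha₀).toLinearMap ∘ₗ LinearMap.proj a₀) (CechC1 Y.hom W) g := by
  induction g using TensorProduct.induction_on with
  | zero => rw [map_zero, map_zero, map_zero]
  | add g g' hg hg' => rw [map_add, map_add, hg, hg', map_add]
  | tmul r c =>
    funext b b'
    rw [sliceMapLeft_apply, thetaVV_tmul, map_mul, comap_sliceLeft_comapFstP ha₀,
      comap_sliceLeft_comapSndP (le_refl (W b ⊓ W b')), Sections.res_self, contractLeft_tmul,
      Pi.smul_apply, Pi.smul_apply, Algebra.smul_def]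
    rfl

end Slices

section SlicesRight

variable {Y W} {y : 𝟙_ (SchemeOver k) ⟶ Y} {b₀ : B} (hb₀ : ratPt Y y ∈ W b₀)

/-- `σ_y : Π Γ((V_a ∩ V_{a'}) × W_b) → Č¹(𝒱)`, `m ↦ (s_y^* m_{a,a',b₀})_{a,a'}` for `y ∈ W_{b₀}`.
[folklore] -/
def sliceMapRight : CechC0 (X ⊗ Y).hom (productFamily X Y (pairInter V) W) →ₗ[k]
    CechC1 X.hom V where
  toFun m a a' :=
    Sections.comap (X ⊗ Y).hom X.hom ((ρ_ X).inv ≫ X ◁ y).left (sliceRight_left_comp_hom X Y y)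
      (le_preimage_sliceRight_P (V := pairInter V) (W := W) (p := ((a, a'), b₀)) hb₀ le_rfl)
      (m ((a, a'), b₀))
  map_add' m m' := by
    funext a a'
    exact map_add (Sections.comap _ _ _ _ _) (m ((a, a'), b₀)) (m' ((a, a'), b₀))
  map_smul' c m := by
    funext a a'
    exact map_smul (Sections.comap _ _ _ _ _) c (m ((a, a'), b₀))

/-- Unfolding of `sliceMapRight`. [folklore] -/
theorem sliceMapRight_apply (m : CechC0 (X ⊗ Y).hom (productFamily X Y (pairInter V) W))
    (a a' : A) :
    sliceMapRight X V hb₀ m a a' =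
      Sections.comap (X ⊗ Y).hom X.hom ((ρ_ X).inv ≫ X ◁ y).left (sliceRight_left_comp_hom X Y y)
        (le_preimage_sliceRight_P (V := pairInter V) (W := W) (p := ((a, a'), b₀)) hb₀ le_rfl)
        (m ((a, a'), b₀)) :=
  rfl

/-- **`σ_y ∘ Θ_h = 1 ⊗ ev_y`.** [folklore] -/
theorem sliceMapRight_thetaHH (g : CechC1 X.hom V ⊗[k] CechC0 Y.hom W) :
    sliceMapRight X V hb₀ (thetaHH X Y V W g) =
      contractRight k ((evalPt hb₀).toLinearMap ∘ₗ LinearMap.proj b₀) (CechC1 X.hom V) g := by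
  induction g using TensorProduct.induction_on with
  | zero => rw [map_zero, map_zero, map_zero]
  | add g g' hg hg' => rw [map_add, map_add, hg, hg', map_add]
  | tmul c s =>
    funext a a'
    rw [sliceMapRight_apply, thetaHH_tmul, map_mul,
      comap_sliceRight_comapFstP (le_refl (V a ⊓ V a')), comap_sliceRight_comapSndP hb₀,
      Sections.res_self, contractRight_tmul, Pi.smul_apply, Pi.smul_apply, Algebra.smul_def,
      mul_comm]
    rfl

end SlicesRight

/-! ### Splitting a cocycle of the product covering -/

section Cocycle

variable {X Y V W} {z : CechC1 (X ⊗ Y).hom (productFamily X Y V W)}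
  (hz : z ∈ cechZ1 (X ⊗ Y).hom (productFamily X Y V W))

variable (X Y V W z) in
/-- The horizontal part `z_h = (z_{(a,b),(a',b)}|_{(V_a ∩ V_{a'}) × W_b})`. [folklore] -/
def horizPart : CechC0 (X ⊗ Y).hom (productFamily X Y (pairInter V) W) := fun t =>
  Sections.res (X ⊗ Y).hom
    (le_inf (prod_pairInter_left_le_fst X Y V W t) (prod_pairInter_left_le_snd X Y V W t))
    (z (t.1.1, t.2) (t.1.2, t.2))

variable (X Y V W z) in
/-- The vertical part `z_v = (z_{(a,b),(a,b')}|_{V_a × (W_b ∩ W_{b'})})`. [folklore] -/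
def vertPart : CechC0 (X ⊗ Y).hom (productFamily X Y V (pairInter W)) := fun t =>
  Sections.res (X ⊗ Y).hom
    (le_inf (prod_pairInter_right_le_fst X Y V W t) (prod_pairInter_right_le_snd X Y V W t))
    (z (t.1, t.2.1) (t.1, t.2.2))

include hz

/-- **The mixed cocycle identity** `δ'_v z_h = δ'_h z_v`: both are
`z_{(a,b'),(a',b')} - z_{(a,b),(a',b)} = z_{(a',b),(a',b')} - z_{(a,b),(a,b')}` on
`(V_a ∩ V_{a'}) × (W_b ∩ W_{b'})`, by the cocycle identity through `(a', b)` and through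
`(a, b')`. [folklore] -/
theorem cocycle_mixed :
    deltaV' X Y V W (horizPart X Y V W z) = deltaH' X Y V W (vertPart X Y V W z) := by
  funext t
  obtain ⟨⟨a, a'⟩, ⟨b, b'⟩⟩ := t
  obtain ⟨h1, h2, h3, h4⟩ := prod_pairInter_both_le X Y V W ((a, a'), (b, b'))
  rw [deltaV', deltaH', cechDiff_apply, cechDiff_apply]
  simp only [horizPart, vertPart, Sections.res_res]
  have c1 := cechZ1.cocycle_res (X ⊗ Y).hom (productFamily X Y V W) hz (a, b) (a', b) (a', b')
    h1 h2 h4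
  have c2 := cechZ1.cocycle_res (X ⊗ Y).hom (productFamily X Y V W) hz (a, b) (a, b') (a', b')
    h1 h3 h4
  linear_combination c2 - c1

/-- **Splitting of the cocycle**: `z_{(a,b),(a',b')} = z_h((a,a'),b)| + z_v(a',(b,b'))|` on
any open `O ⊆ (V_a × W_b) ∩ (V_{a'} × W_{b'})` (cocycle identity through `(a', b)`). [folklore] -/
theorem cocycle_split (a a' : A) (b b' : B) {O : (X ⊗ Y).left.Opens}
    (hO : O ≤ productFamily X Y V W (a, b) ⊓ productFamily X Y V W (a', b'))
    (h₁ : O ≤ productFamily X Y (pairInter V) W ((a, a'), b))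
    (h₂ : O ≤ productFamily X Y V (pairInter W) (a', (b, b'))) :
    Sections.res (X ⊗ Y).hom hO (z (a, b) (a', b')) =
      Sections.res (X ⊗ Y).hom h₁ (horizPart X Y V W z ((a, a'), b)) +
        Sections.res (X ⊗ Y).hom h₂ (vertPart X Y V W z (a', (b, b'))) := by
  simp only [horizPart, vertPart, Sections.res_res]
  have c1 := cechZ1.cocycle_res (X ⊗ Y).hom (productFamily X Y V W) hz (a, b) (a', b) (a', b')
    (hO.trans inf_le_left) (h₁.trans (prod_pairInter_left_le_snd X Y V W ((a, a'), b)))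
    (hO.trans inf_le_right)
  linear_combination -c1

end Cocycle

/-! ### The slices give coboundaries -/

section Main

variable {X Y V W}

/-- A Čech differential kills the unit cochain. [folklore] -/
theorem cechD0_one {S : Scheme.{u}} (f : S ⟶ Spec (.of k)) {ι : Type u} (U : ι → S.Opens) :
    cechD0 f U 1 = 0 := by
  funext i j
  rw [cechD0_apply, Pi.one_apply, Pi.one_apply, map_one, map_one, sub_self]
  rfl

/-- The evaluation functional `r ↦ r_{a₀}(x)` takes the value `1` on the unit cochain.
[folklore] -/
theorem evalPt_proj_one {x : 𝟙_ (SchemeOver k) ⟶ X} {a₀ : A} (ha₀ : ratPt X x ∈ V a₀) :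
    ((evalPt ha₀).toLinearMap ∘ₗ LinearMap.proj a₀) (1 : CechC0 X.hom V) = 1 := by
  change evalPt ha₀ ((1 : CechC0 X.hom V) a₀) = 1
  rw [Pi.one_apply, map_one]

/-- **The slice `{x} × Y` gives a coboundary**: if `s_x^* z = d⁰ g_x` on `s_x⁻¹𝒫` and
`Θ_v v = z_v`, then `(ev_x ⊗ 1) v = d⁰ e` for the cochain `e_b = (g_x)_{(a₀,b)}|_{W_b}` of `𝒲`.
[folklore] -/
theorem slice_left_coboundary {x : 𝟙_ (SchemeOver k) ⟶ X} {a₀ : A} (ha₀ : ratPt X x ∈ V a₀)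
    {z : CechC1 (X ⊗ Y).hom (productFamily X Y V W)}
    (gx : CechC0 Y.hom (preimageFamily ((λ_ Y).inv ≫ x ▷ Y).left (productFamily X Y V W)))
    (hgx : cechD0 Y.hom _ gx = cechComapC1 (X ⊗ Y).hom Y.hom ((λ_ Y).inv ≫ x ▷ Y).left
      (sliceLeft_left_comp_hom X Y x) (productFamily X Y V W) z)
    {v : CechC0 X.hom V ⊗[k] CechC1 Y.hom W} (hv : thetaVV X Y V W v = vertPart X Y V W z) :
    ∃ e : CechC0 Y.hom W,
      contractLeft k ((evalPt ha₀).toLinearMap ∘ₗ LinearMap.proj a₀) (CechC1 Y.hom W) v =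
        cechD0 Y.hom W e := by
  refine ⟨fun b => Sections.res Y.hom (le_preimage_sliceLeft_P (p := (a₀, b)) ha₀ le_rfl)
    (gx (a₀, b)), ?_⟩
  rw [← sliceMapLeft_thetaVV, hv]
  funext b b'
  have key := congrArg (Sections.res Y.hom
    (le_inf (le_preimage_sliceLeft_P (p := (a₀, b)) ha₀ inf_le_left)
      (le_preimage_sliceLeft_P (p := (a₀, b')) ha₀ inf_le_right) :
      W b ⊓ W b' ≤ ((λ_ Y).inv ≫ x ▷ Y).left ⁻¹ᵁ productFamily X Y V W (a₀, b) ⊓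
        ((λ_ Y).inv ≫ x ▷ Y).left ⁻¹ᵁ productFamily X Y V W (a₀, b')))
    (congr_fun (congr_fun hgx (a₀, b)) (a₀, b'))
  rw [cechD0_apply, map_sub, Sections.res_res, Sections.res_res, cechComapC1_apply] at key
  replace key := key.trans (Sections.res_comap _ _ _ _ _ _ _)
  rw [cechD0_apply, sliceMapLeft_apply]
  simp only [vertPart, Sections.res_res, Sections.comap_res]
  exact key.symm

/-- **The slice `X × {y}` gives a coboundary** (mirror statement). [folklore] -/
theorem slice_right_coboundary {y : 𝟙_ (SchemeOver k) ⟶ Y} {b₀ : B} (hb₀ : ratPt Y y ∈ W b₀)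
    {z : CechC1 (X ⊗ Y).hom (productFamily X Y V W)}
    (gy : CechC0 X.hom (preimageFamily ((ρ_ X).inv ≫ X ◁ y).left (productFamily X Y V W)))
    (hgy : cechD0 X.hom _ gy = cechComapC1 (X ⊗ Y).hom X.hom ((ρ_ X).inv ≫ X ◁ y).left
      (sliceRight_left_comp_hom X Y y) (productFamily X Y V W) z)
    {h : CechC1 X.hom V ⊗[k] CechC0 Y.hom W} (hh : thetaHH X Y V W h = horizPart X Y V W z) :
    ∃ f : CechC0 X.hom V,
      contractRight k ((evalPt hb₀).toLinearMap ∘ₗ LinearMap.proj b₀) (CechC1 X.hom V) h =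
        cechD0 X.hom V f := by
  refine ⟨fun a => Sections.res X.hom (le_preimage_sliceRight_P (p := (a, b₀)) hb₀ le_rfl)
    (gy (a, b₀)), ?_⟩
  rw [← sliceMapRight_thetaHH, hh]
  funext a a'
  have key := congrArg (Sections.res X.hom
    (le_inf (le_preimage_sliceRight_P (p := (a, b₀)) hb₀ inf_le_left)
      (le_preimage_sliceRight_P (p := (a', b₀)) hb₀ inf_le_right) :
      V a ⊓ V a' ≤ ((ρ_ X).inv ≫ X ◁ y).left ⁻¹ᵁ productFamily X Y V W (a, b₀) ⊓
        ((ρ_ X).inv ≫ X ◁ y).left ⁻¹ᵁ productFamily X Y V W (a', b₀)))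
    (congr_fun (congr_fun hgy (a, b₀)) (a', b₀))
  rw [cechD0_apply, map_sub, Sections.res_res, Sections.res_res, cechComapC1_apply] at key
  replace key := key.trans (Sections.res_comap _ _ _ _ _ _ _)
  rw [cechD0_apply, sliceMapRight_apply]
  simp only [horizPart, Sections.res_res, Sections.comap_res]
  exact key.symm

/-- **The cochain-level Künneth argument.** For finite affine coverings `(V_a)`, `(W_b)` with
affine pairwise intersections, rational points `x ∈ V_{a₀}`, `y ∈ W_{b₀}` of the integral
universally closed `k`-schemes `X`, `Y`, and a `1`-cocycle `z` of the product covering whose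
pullbacks to the slices `{x} × Y`, `X × {y}` are coboundaries, `z` is a coboundary (steps 1–5
of the module docstring).
[cite: GortzWedhorn2023, Thm. 24.73 proof with Cor. 22.110 and Prop. F.95] -/
theorem exists_cechD0_eq_of_slices [Finite A] [Finite B] [IsIntegral X.left] [IsIntegral Y.left]
    [UniversallyClosed X.hom] [UniversallyClosed Y.hom] (hVaff : ∀ a, IsAffineOpen (V a))
    (hWaff : ∀ b, IsAffineOpen (W b)) (hVcov : ⨆ a, V a = ⊤) (hWcov : ⨆ b, W b = ⊤)
    (hV₂ : ∀ aa, IsAffineOpen (pairInter V aa)) (hW₂ : ∀ bb, IsAffineOpen (pairInter W bb))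
    {x : 𝟙_ (SchemeOver k) ⟶ X} {a₀ : A} (ha₀ : ratPt X x ∈ V a₀)
    {y : 𝟙_ (SchemeOver k) ⟶ Y} {b₀ : B} (hb₀ : ratPt Y y ∈ W b₀)
    {z : CechC1 (X ⊗ Y).hom (productFamily X Y V W)}
    (hz : z ∈ cechZ1 (X ⊗ Y).hom (productFamily X Y V W))
    (gx : CechC0 Y.hom (preimageFamily ((λ_ Y).inv ≫ x ▷ Y).left (productFamily X Y V W)))
    (hgx : cechD0 Y.hom _ gx = cechComapC1 (X ⊗ Y).hom Y.hom ((λ_ Y).inv ≫ x ▷ Y).left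
      (sliceLeft_left_comp_hom X Y x) (productFamily X Y V W) z)
    (gy : CechC0 X.hom (preimageFamily ((ρ_ X).inv ≫ X ◁ y).left (productFamily X Y V W)))
    (hgy : cechD0 X.hom _ gy = cechComapC1 (X ⊗ Y).hom X.hom ((ρ_ X).inv ≫ X ◁ y).left
      (sliceRight_left_comp_hom X Y y) (productFamily X Y V W) z) :
    ∃ γ : CechC0 (X ⊗ Y).hom (productFamily X Y V W),
      cechD0 (X ⊗ Y).hom (productFamily X Y V W) γ = z := by
  -- transport the two parts of `z`
  obtain ⟨h, hh⟩ := thetaHH_surjective X Y V W hV₂ hWaff (horizPart X Y V W z)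
  obtain ⟨v, hv⟩ := thetaVV_surjective X Y V W hVaff hW₂ (vertPart X Y V W z)
  -- the mixed cocycle identity transports to `(1 ⊗ d) h = (d ⊗ 1) v`
  have hmix : (cechD0 Y.hom W).lTensor _ h = (cechD0 X.hom V).rTensor _ v := by
    apply thetaHV_injective X Y V W hV₂ hW₂
    rw [thetaHV_lTensor_cechD0, thetaHV_rTensor_cechD0, hh, hv]
    exact cocycle_mixed hz
  -- the abstract degree-one Künneth lemma
  obtain ⟨g, hg1, hg2⟩ := exists_tensor_primitive_of_slices (cechD0 X.hom V) (cechD0 Y.hom W)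
    1 1 ((evalPt ha₀).toLinearMap ∘ₗ LinearMap.proj a₀)
    ((evalPt hb₀).toLinearMap ∘ₗ LinearMap.proj b₀) (cechD0_one X.hom V) (cechD0_one Y.hom W)
    (evalPt_proj_one ha₀) (evalPt_proj_one hb₀)
    (fun r hr hr0 => cechC0_eq_zero_of_cechD0_eq_zero hVcov ha₀ r hr hr0)
    (fun w hw hw0 => cechC0_eq_zero_of_cechD0_eq_zero hWcov hb₀ w hw hw0) h v hmix
    (slice_left_coboundary ha₀ gx hgx hv) (slice_right_coboundary hb₀ gy hgy hh)
  -- `γ = Θ₀ g` is a primitive of `z`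
  refine ⟨kunnethSectionsPi X Y V W g, ?_⟩
  have eh : horizPart X Y V W z = deltaH X Y V W (kunnethSectionsPi X Y V W g) := by
    rw [← hh, ← hg1, thetaHH_rTensor_cechD0]
  have ev : vertPart X Y V W z = deltaV X Y V W (kunnethSectionsPi X Y V W g) := by
    rw [← hv, ← hg2, thetaVV_lTensor_cechD0]
  funext p q
  obtain ⟨a, b⟩ := p
  obtain ⟨a', b'⟩ := q
  have split := cocycle_split hz a a' b b' le_rfl
    ((inf_productFamily_le_both X Y V W a a' b b').trans
      (prod_pairInter_both_le_left_fst X Y V W ((a, a'), (b, b'))))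
    ((inf_productFamily_le_both X Y V W a a' b b').trans
      (prod_pairInter_both_le_right_snd X Y V W ((a, a'), (b, b'))))
  rw [Sections.res_self] at split
  rw [split, eh, ev, deltaH, deltaV, cechDiff_apply, cechDiff_apply, map_sub, map_sub,
    Sections.res_res, Sections.res_res, Sections.res_res, Sections.res_res, cechD0_apply]
  abel

end Main

end Product

/-! ### The theorem -/

/-- **Künneth injectivity for `Ȟ¹(𝒪)` on a finite affine product covering** — discharge of the
named fact `kunneth_cechH1_productCover_slices_injective` (Görtz–Wedhorn II, proof of Thm. 24.73
with Cor. 22.110, `H⁰(X) = H⁰(Y) = k` by Görtz–Wedhorn I, Prop. 12.66, and Thm. 22.9), by the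
cochain-level Künneth argument `exists_cechD0_eq_of_slices`: `X`, `Y` are integral
(geometrically integral over a field), universally closed over `k` (proper) and separated, so
that the pairwise intersections of the affine opens `V_a`, `W_b` are affine.
[cite: GortzWedhorn2023, Thm. 24.73 proof with Cor. 22.110, Prop. F.95 and Thm. 22.9] -/
theorem kunneth_cechH1_productCover_slices_injective_holds :
    kunneth_cechH1_productCover_slices_injective.{u} := by
  intro k _ X Y _ _ _ _ x y A B _ _ V W hVaff hWaff hVcov hWcov c hx hy
  -- `X`, `Y` are integral and separated
  haveI : Subsingleton ↥(Spec (CommRingCat.of k)) :=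
    inferInstanceAs (Subsingleton (PrimeSpectrum k))
  haveI : IsIntegral X.left := GeometricallyIntegral.isIntegral_of_subsingleton X.hom
  haveI : IsIntegral Y.left := GeometricallyIntegral.isIntegral_of_subsingleton Y.hom
  haveI : X.left.IsSeparated := ⟨by rw [← terminal.comp_from X.hom]; infer_instance⟩
  haveI : Y.left.IsSeparated := ⟨by rw [← terminal.comp_from Y.hom]; infer_instance⟩
  have hV₂ : ∀ aa, IsAffineOpen (pairInter V aa) := fun aa => (hVaff aa.1).inf (hVaff aa.2)
  have hW₂ : ∀ bb, IsAffineOpen (pairInter W bb) := fun bb => (hWaff bb.1).inf (hWaff bb.2)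
  -- the rational points lie in some members of the coverings
  obtain ⟨a₀, ha₀⟩ : ∃ a, ratPt X x ∈ V a := Opens.mem_iSup.mp (by rw [hVcov]; trivial)
  obtain ⟨b₀, hb₀⟩ : ∃ b, ratPt Y y ∈ W b := Opens.mem_iSup.mp (by rw [hWcov]; trivial)
  -- a cocycle representing `c`, and the coboundaries on the slices
  obtain ⟨⟨z, hz⟩, rfl⟩ := CechH1.mk_surjective _ _ c
  obtain ⟨gx, hgx⟩ := (mem_cechB1_iff _ _ _).mp ((cechComapH1_mk_eq_zero_iff _ _ _ _ _ _).mp hx)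
  obtain ⟨gy, hgy⟩ := (mem_cechB1_iff _ _ _).mp ((cechComapH1_mk_eq_zero_iff _ _ _ _ _ _).mp hy)
  rw [CechH1.mk_eq_zero_iff, mem_cechB1_iff]
  exact exists_cechD0_eq_of_slices hVaff hWaff hVcov hWcov hV₂ hW₂ ha₀ hb₀ hz gx hgx gy hgy

/-- **Künneth injectivity for `Ȟ¹(𝒪)` of a product, arbitrary affine covering** — the named
fact `kunneth_cechH1_slices_injective` of `Motives/KunnethH1Slices` holds (reduction
`kunneth_cechH1_slices_injective_of_productCover'` of `Motives/KunnethH1SlicesProofs` applied to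
`kunneth_cechH1_productCover_slices_injective_holds`).
[cite: GortzWedhorn2023, Thm. 24.73 proof with Cor. 22.110 and Thm. 22.9] -/
theorem kunneth_cechH1_slices_injective_holds : kunneth_cechH1_slices_injective.{u} :=
  kunneth_cechH1_slices_injective_of_productCover'
    kunneth_cechH1_productCover_slices_injective_holds

end Literature.AlgebraicGeometry.Motives

end
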